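/-
Copyright (c) 2026. All rights reserved.
Released under Apache 2.0 license as described in the file LICENSE.
Authors: abc-iut cell, Cor. 3.12 sub-crew seat abc-iut-c312-3 (gen 9).
-/
import Literature.IUT.LogVolume.UnitLogInnerRadiusTieRoots
import HarnessLib

/-!
# The inner radius at a TIE index `e = A·(p−1)` (`p` odd, `p ∤ A`), IV: the FIRST-ORDER TEST for the bit
# «`ζ_p ∈ K`?» — `‖x^{p−1} + p‖ < ‖p‖` for some `x`, i.e. `−p·ϖ^{−e}` is a `(p−1)`-th power residue

Proof-only appendix (theorems, no definitions, no named fact) to parts I–II (`UnitLogInnerRadiusTie`, `…Roots`).  The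
tie dichotomy `r_in = e/(p−1) + [ζ_p ∈ K]` (`innerRadius_tie_dichotomy`) leaves ONE bit per place; this file
makes it DECIDABLE BY LOCAL ARITHMETIC at every index `e = A·(p−1)` with `p ∤ A` (`p` odd), generalising
abc-iut-w4/w6's `UnitLogBoundaryRamificationRootsCriterion` (the case `A = 1`):

* `exists_pow_prime_eq_one_ne_one_iff_exists_unit_zero_level` — `K ∋ ζ ≠ 1` with `ζ^p = 1` **iff** some UNIT
  `a` has `a + c·a^p ∈ 𝔪`, `c = ϖ^e/p` (the LIFT of part II and its converse);
* `norm_add_mul_pow_lt_one_iff_level` — for a unit `a`: `a + c·a^p ∈ 𝔪 ⟺ ‖(ϖ^A·a)^{p−1} + p‖ < ‖p‖`;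
* **`exists_pow_prime_eq_one_ne_one_iff_exists_norm_pow_add_lt_level`** — `ζ_p ∈ K` **iff
  `‖x^{p−1} + p‖ < ‖p‖` for some `x ∈ K`** (then `‖x‖ = ‖ϖ‖^A` automatically): «`−p` is a `(p−1)`-th power to
  first order», equivalently «the residue class of `−p·ϖ^{−e}` is a `(p−1)`-th power in `𝒪_K/𝔪_K`» — a finite
  check on the residue field for the numerics seats (classically `ℚ_p(ζ_p) = ℚ_p((−p)^{1/(p−1)})`);
* `innerRadius_tie_of_forall_norm_pow_add_ge` — the inner-radius verdict `r_in = e/(p−1)` of part II keyed by the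
  FAILURE of the first-order test; when the test SUCCEEDS, `exists_pow_prime_eq_one_ne_one_of_norm_pow_add_lt`
  feeds part III's `innerRadius_tie_of_pow_prime_eq_one` (`r_in = e/(p−1) + 1`).
Sibling (same hour, abc-iut-rp-d4): `UnitLogValuationProfileNoZetaCriterion` phrases the bit as the first-order
condition (NZ) «no unit zero of the residue polynomial» and proves (NZ) ⟺ «no `ζ_p`» through the same lift;
this file's `(p−1)`-th-power-residue form is the one a residue-field computation decides directly.

References: [cite: Washington1997, Lemma 1.4, §5.1] [cite: NeukirchANT1999, Ch. II Prop. (5.7), (7.13)].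
Classical; `logUnits` is the cell's typing of [IUTchIV] Prop. 1.2's `log_p(R^×)` ([claim: Mochizuki2012,
status: disputed] for that locution only).  Consumer (record only): D-0079 R-W lane U, column «rho_in» at tie
places (HEX `p = 7`, `6 ∣ e_w`: test whether `−7·ϖ_w^{−e_w}` is a sixth power in the residue field of `K_w`).
Nothing here is disputed mathematics; no IUT statement is asserted; nothing bears on [IUTchIII] Cor. 3.12.
-/

noncomputable section

open Metric Set
open scoped NormedField

namespace Literature.IUT.LogVolume

namespace LogEnvelope

open RamificationCriterion BoundaryRamification Literature.NumberTheory.GaloisRepresentations.Ultrametric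

section Field

variable (p : ℕ) [hp : Fact p.Prime]
variable {K : Type*} [NontriviallyNormedField K] [instK : NormedAlgebra ℚ_[p] K] [IsUltrametricDist K]
  [ProperSpace K]
variable {ϖ : Kˣ} (hϖ : IsUniformizer ϖ) {A : ℕ} (hA : absRamificationIdx p K = A * (p - 1))
include hϖ hA

/-- **`ζ_p ∈ K` iff the level-`A` residue polynomial has a UNIT zero** (`p` odd, `e = A(p−1)`, `p ∤ A`): `K`
has `ζ ≠ 1` with `ζ^p = 1` iff some `a` with `‖a‖ = 1` satisfies `‖a + (ϖ^e/p)·a^p‖ < 1` (parts II: the lift and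
its converse). [cite: Washington1997, Lemma 1.4, §5.1] -/
theorem exists_pow_prime_eq_one_ne_one_iff_exists_unit_zero_level (hp2 : p ≠ 2) (hpA : ¬ p ∣ A) :
    (∃ ζ : K, ζ ^ p = 1 ∧ ζ ≠ 1) ↔
      ∃ a : K, ‖a‖ = 1 ∧ ‖a + (ϖ : K) ^ absRamificationIdx p K / (p : K) * a ^ p‖ < 1 := by
  constructor
  · rintro ⟨ζ, hζ, hζ1⟩
    obtain ⟨a, ha, -, hΛ⟩ := exists_unit_zero_of_pow_prime_eq_one p hϖ hA hp2 hpA hζ hζ1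
    exact ⟨a, ha, hΛ⟩
  · rintro ⟨a, ha, hΛ⟩
    exact exists_pow_prime_eq_one_of_unit_zero p hϖ hA hp2 hpA ha hΛ

omit hϖ in
/-- For a unit `a`: **`a + c·a^p ∈ 𝔪 ⟺ ‖(ϖ^A·a)^{p−1} + p‖ < ‖p‖`** (`a + c·a^p = a·((ϖ^A a)^{p−1} + p)/p`, since
`A·(p−1) = e`). [cite: Washington1997, §5.1] -/
theorem norm_add_mul_pow_lt_one_iff_level (a : K) (ha : ‖a‖ = 1) :
    ‖a + (ϖ : K) ^ absRamificationIdx p K / (p : K) * a ^ p‖ < 1 ↔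
      ‖((ϖ : K) ^ A * a) ^ (p - 1) + p‖ < ‖(p : K)‖ := by
  have hp0 : (p : K) ≠ 0 := prime_ne_zero p K
  have hpn : 0 < ‖(p : K)‖ := norm_pos_iff.mpr hp0
  have hap : a ^ p = a * a ^ (p - 1) := by
    rw [← pow_succ', Nat.sub_add_cancel hp.out.one_lt.le]
  have hϖe : (ϖ : K) ^ absRamificationIdx p K = ((ϖ : K) ^ A) ^ (p - 1) := by rw [← pow_mul, hA]
  have hrew : a + (ϖ : K) ^ absRamificationIdx p K / (p : K) * a ^ p =
      a * ((((ϖ : K) ^ A * a) ^ (p - 1) + p)) / p := by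
    rw [hap, hϖe, mul_pow]
    field_simp
    ring
  rw [hrew, norm_div, norm_mul, ha, one_mul, div_lt_one hpn]

/-- **`ζ_p ∈ K` iff `−p` is a `(p−1)`-th power to first order** (`p` odd, `e = A(p−1)`, `p ∤ A`): `K` has `ζ ≠ 1`
with `ζ^p = 1` **iff `‖x^{p−1} + p‖ < ‖p‖` for some `x ∈ K`** (such an `x` has `‖x‖^{p−1} = ‖p‖`, i.e. `‖x‖ = ‖ϖ‖^A`,
and `a := x/ϖ^A` is a unit zero of the residue polynomial).  Equivalently: the residue class of `−p·ϖ^{−e}` is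
a `(p−1)`-th power in `𝒪_K/𝔪_K`. [cite: Washington1997, Lemma 1.4] [cite: NeukirchANT1999, Ch. II Prop. (7.13)] -/
theorem exists_pow_prime_eq_one_ne_one_iff_exists_norm_pow_add_lt_level (hp2 : p ≠ 2) (hpA : ¬ p ∣ A) :
    (∃ ζ : K, ζ ^ p = 1 ∧ ζ ≠ 1) ↔ ∃ x : K, ‖x ^ (p - 1) + p‖ < ‖(p : K)‖ := by
  have hρ0 : 0 < ‖(ϖ : K)‖ := norm_units_pos ϖ
  have hϖA0 : (ϖ : K) ^ A ≠ 0 := pow_ne_zero _ ϖ.ne_zero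
  have hq1 : 1 ≤ p - 1 := by have := hp.out.two_le; omega
  rw [exists_pow_prime_eq_one_ne_one_iff_exists_unit_zero_level p hϖ hA hp2 hpA]
  constructor
  · rintro ⟨a, ha, hΛ⟩
    exact ⟨(ϖ : K) ^ A * a, (norm_add_mul_pow_lt_one_iff_level p hA a ha).1 hΛ⟩
  · rintro ⟨x, hx⟩
    -- `‖x^{p−1}‖ = ‖p‖ = (‖ϖ‖^A)^{p−1}`, so `‖x‖ = ‖ϖ‖^A` and `a := x/ϖ^A` is a unit
    have hxp : ‖x ^ (p - 1)‖ = ‖(p : K)‖ := by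
      by_contra hne
      have h := IsUltrametricDist.norm_add_eq_max_of_norm_ne_norm hne
      rw [h] at hx
      exact absurd hx (not_lt.mpr (le_max_right _ _))
    rw [norm_pow, norm_prime_eq_norm_pow p K hϖ, hA, pow_mul] at hxp
    have hxn : ‖x‖ = ‖(ϖ : K)‖ ^ A :=
      (pow_left_inj₀ (norm_nonneg _) (pow_nonneg hρ0.le _) (by omega)).1 hxp
    have ha : ‖x / (ϖ : K) ^ A‖ = 1 := by
      rw [norm_div, hxn, norm_pow, div_self (pow_ne_zero _ hρ0.ne')]
    refine ⟨x / (ϖ : K) ^ A, ha, ?_⟩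
    rw [norm_add_mul_pow_lt_one_iff_level p hA _ ha, mul_div_cancel₀ _ hϖA0]
    exact hx

/-- **Inner radius `e/(p−1)` when the first-order test FAILS everywhere** (`‖x^{p−1} + p‖ ≥ ‖p‖` for all `x`,
i.e. `ζ_p ∉ K`): `closedBall 0 ‖ϖ‖^A ⊆ log_p(𝒪_K^×) ∧ ¬ closedBall 0 ‖ϖ‖^{A−1} ⊆ log_p(𝒪_K^×)`.
[cite: NeukirchANT1999, Ch. II Prop. (5.5)–(5.7)] -/
theorem innerRadius_tie_of_forall_norm_pow_add_ge (hp2 : p ≠ 2) (hpA : ¬ p ∣ A)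
    (hμ : ∀ x : K, ‖(p : K)‖ ≤ ‖x ^ (p - 1) + p‖) :
    closedBall (0 : K) (‖(ϖ : K)‖ ^ A) ⊆ logUnits K ∧
      ¬ closedBall (0 : K) (‖(ϖ : K)‖ ^ (A - 1)) ⊆ logUnits K := by
  refine innerRadius_tie_of_forall_pow_prime_eq_one p hϖ hA hp2 hpA fun ζ hζ => ?_
  by_contra hζ1
  obtain ⟨x, hx⟩ := (exists_pow_prime_eq_one_ne_one_iff_exists_norm_pow_add_lt_level p hϖ hA hp2 hpA).1
    ⟨ζ, hζ, hζ1⟩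
  exact absurd hx (not_lt.mpr (hμ x))

/-- **The first-order test SUCCEEDS ⇒ `ζ_p ∈ K`** (then part III's `innerRadius_tie_of_pow_prime_eq_one` gives
`r_in = e/(p−1) + 1`: `closedBall 0 ‖ϖ‖^{A+1} ⊆ log_p(𝒪_K^×) ∧ ¬ closedBall 0 ‖ϖ‖^A ⊆ log_p(𝒪_K^×)`).
[cite: Washington1997, Lemma 1.4] -/
theorem exists_pow_prime_eq_one_ne_one_of_norm_pow_add_lt (hp2 : p ≠ 2) (hpA : ¬ p ∣ A) {x : K}
    (hx : ‖x ^ (p - 1) + p‖ < ‖(p : K)‖) : ∃ ζ : K, ζ ^ p = 1 ∧ ζ ≠ 1 :=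
  (exists_pow_prime_eq_one_ne_one_iff_exists_norm_pow_add_lt_level p hϖ hA hp2 hpA).2 ⟨x, hx⟩

end Field

end LogEnvelope

end Literature.IUT.LogVolume

end
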